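import Mathlib
import Summits.MatrixMultiplication.MatrixMultiplication.Theorems.SubgroupIdentityDesigns.Negative.LevelKCornerSlice

/-!
# Level `k` sandwich triples in the window `2k ≤ m`: the partial corner slice
(negative-lemma support for the crux `SubgroupIdentityDesigns`, stmt-MatrixMultiplication-14079; line
`ghost-calculus-chebotarev`, stub `stub_levelKPartialCornerSlice`; the rank-conditional version of
`Negative.LevelKCornerSlice`, valid for all `m ≥ 2k`)

In `G = GL_m(𝔽_p)` with `2k ≤ m`, let `U⁻ = {[[1,0],[X,1]]}` (blocks along `Fin k ⊕ Fin (m - k)`; `u - 1`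
supported in rows `≥ k`, columns `< k`) and `U⁺ = {[[1,Z],[0,1]]}`.  Suppose `U⁻ ≤ H₁`, `U⁺ ≤ H₃` and the
triple `(H₁, H₂, H₃)` passes the level-`k` identity test of the crux.  Then every product `x = abg` whose
top-left `k × k` block is the identity factors as `x = u t v` with `u ∈ U⁻`, `v ∈ U⁺` and `t = diag(1, D)`
CORNER-shaped (`t - 1` supported in rows `≥ k`, columns `≥ k`), and EITHER `t = 1` OR
`2(m - 2k) < rank (t - 1)` (`stub_levelKPartialCornerSlice`).

Proof.  Write `x = [[1, r],[c, B]] = g(c, D, r) = g(c,1,0) · diag(1,D) · g(0,1,r)` with the Schur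
complement `D = B - c r` (`g = blockPt` of `Negative.LeviCollision`); this is the factorisation, and
`rank (t - 1) ≥ rank (D - 1)`.  If `D ≠ 1` and `rank (D - 1) ≤ 2(r - k)` (`r = m - k`), a LEVI-COLLISION
PAIR `γ (D - 1) β = 0` (`γ` right-invertible `k × r`, `β` left-invertible `r × k`) exists
(`exists_leviCollision_pair_of_rank_le`: with `N = ker (D - 1)`, take a `k`-dimensional `W` with
`W ≤ N` or `N ≤ W`, so that `dim (D-1)W ≤ r - k`; `β` = a basis of `W`, `γ` = `k` coordinates of
`𝔽_p^r / (D-1)W`), and `no_idTest_of_leviCollision` refutes the identity test exactly as in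
`LevelKCornerSlice.false_of_idTest_of_schur_ne_one`.
-/

set_option linter.dupNamespace false

noncomputable section

open scoped BigOperators
open Matrix

namespace Summit.MatrixMultiplication.MatrixMultiplication.Theorems.SubgroupIdentityDesigns.Negative

namespace LevelKPartialCornerSlice

open Summit.MatrixMultiplication.MatrixMultiplication.Theorems.LieRankDesigns.Negative (GLm Mat)
open LevelOneCornerSlice (blockPt_one_zero_mul blockPt_mul_zero_one det_blockPt eq_blockPt_of_toBlocks₁₁
  reindex_mul_reindex reindex_sub_one_apply exists_gl_val_eq)
open LevelKCornerSlice (lower_of_val_eq upper_of_val_eq)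

section Existence

variable {F : Type*} [Field F]

/-- A finite-dimensional subspace `N` contains a subspace of every dimension `d ≤ dim N`. [folklore] -/
theorem exists_le_finrank_eq {V : Type*} [AddCommGroup V] [Module F V] [FiniteDimensional F V]
    (N : Submodule F V) {d : ℕ} (hd : d ≤ Module.finrank F N) :
    ∃ W : Submodule F V, W ≤ N ∧ Module.finrank F W = d := by
  obtain ⟨f, hf⟩ := finrank_le_iff_exists_linearMap.1
    (show Module.finrank F (Fin d → F) ≤ Module.finrank F N by simpa using hd)
  have hinj : Function.Injective (N.subtype ∘ₗ f) := fun x y hxy => hf (N.injective_subtype hxy)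
  refine ⟨LinearMap.range (N.subtype ∘ₗ f), ?_, ?_⟩
  · rw [LinearMap.range_comp]
    exact Submodule.map_subtype_le N _
  · rw [LinearMap.finrank_range_of_inj hinj]
    simp

/-- **Collision pairs exist when `rank A ≤ 2(r - k)` (`k ≤ r`).**  There are `γ` (`k × r`, right
invertible) and `β` (`r × k`, left invertible) with `γ A β = 0`: with `N = ker A` choose a `k`-dimensional
`W = N' ⊕ W'`, `N' ≤ N` of dimension `min(k, dim N)`, `W'` in a complement of `N`; then
`dim (A W) ≤ k - min(k, dim N) ≤ r - k`, so `k` independent functionals vanish on `A W` (rows of `γ`), and the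
columns of `β` are a basis of `W`. -/
theorem exists_leviCollision_pair_of_rank_le {k r : ℕ} (hkr : k ≤ r) (A : Matrix (Fin r) (Fin r) F)
    (hA : A.rank ≤ 2 * (r - k)) :
    ∃ (γ : Matrix (Fin k) (Fin r) F) (β : Matrix (Fin r) (Fin k) F) (γ' : Matrix (Fin r) (Fin k) F)
      (β' : Matrix (Fin k) (Fin r) F), γ * γ' = 1 ∧ β' * β = 1 ∧ γ * A * β = 0 := by
  set T : (Fin r → F) →ₗ[F] (Fin r → F) := Matrix.toLin' A with hT
  set N : Submodule F (Fin r → F) := LinearMap.ker T with hN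
  set n := Module.finrank F N with hn
  -- rank-nullity: `rank A + dim N = r`
  have hrn : A.rank + n = r := by
    have h := LinearMap.finrank_range_add_finrank_ker T
    rw [Module.finrank_fin_fun] at h
    exact h
  -- Step 1: a `k`-dimensional `W` with `dim T(W) ≤ r - k`
  obtain ⟨W, hWk, hWT⟩ : ∃ W : Submodule F (Fin r → F), Module.finrank F W = k ∧
      Module.finrank F (W.map T) ≤ r - k := by
    obtain ⟨C, hC⟩ := N.exists_isCompl
    have hNC := Submodule.finrank_add_eq_of_isCompl hC
    rw [Module.finrank_fin_fun] at hNC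
    obtain ⟨N', hN'N, hN'⟩ := exists_le_finrank_eq N (d := min k n) (min_le_right k n)
    obtain ⟨W', hW'C, hW'⟩ := exists_le_finrank_eq C (d := k - min k n) (by omega)
    refine ⟨N' ⊔ W', ?_, ?_⟩
    · have hdisj : N' ⊓ W' = ⊥ := (hC.disjoint.mono hN'N hW'C).eq_bot
      have h := Submodule.finrank_sup_add_finrank_inf_eq N' W'
      rw [hdisj, finrank_bot, add_zero, hN', hW'] at h
      omega
    · have hmap : (N' ⊔ W').map T = W'.map T := by
        rw [Submodule.map_sup, LinearMap.le_ker_iff_map.1 (hN'N.trans (le_of_eq hN.symm)), bot_sup_eq]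
      rw [hmap]
      calc Module.finrank F (W'.map T) ≤ Module.finrank F W' := Submodule.finrank_map_le T W'
        _ = k - min k n := hW'
        _ ≤ r - k := by omega
  -- Step 2: `β` = a basis of `W` (columns), `β'` = a left inverse
  let eW : W ≃ₗ[F] (Fin k → F) := LinearEquiv.ofFinrankEq W (Fin k → F) (by simp [hWk])
  let φ : (Fin k → F) →ₗ[F] (Fin r → F) := W.subtype ∘ₗ eW.symm.toLinearMap
  have hφ : LinearMap.ker φ = ⊥ :=
    LinearMap.ker_eq_bot.2 (W.injective_subtype.comp eW.symm.injective)
  obtain ⟨ψ, hψ⟩ := φ.exists_leftInverse_of_injective hφ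
  -- Step 3: `γ` = the first `k` coordinates of `F^r / T(W)` (dimension `≥ k`), `γ'` = a right inverse
  set V' : Submodule F (Fin r → F) := W.map T with hV'
  set q := Module.finrank F ((Fin r → F) ⧸ V') with hq
  have hkq : k ≤ q := by
    have h := V'.finrank_quotient_add_finrank
    rw [Module.finrank_fin_fun] at h
    omega
  let eQ : ((Fin r → F) ⧸ V') ≃ₗ[F] (Fin q → F) :=
    LinearEquiv.ofFinrankEq _ _ (by rw [Module.finrank_fin_fun, hq])
  let π : (Fin r → F) →ₗ[F] (Fin k → F) := cutLin F hkq ∘ₗ eQ.toLinearMap ∘ₗ V'.mkQ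
  have hπ : LinearMap.range π = ⊤ := by
    rw [LinearMap.range_eq_top]
    intro y
    obtain ⟨v, hv⟩ := V'.mkQ_surjective (eQ.symm (padLin F hkq y))
    refine ⟨v, ?_⟩
    have h2 := LinearMap.congr_fun (cutLin_comp_padLin (F := F) hkq) y
    rw [LinearMap.comp_apply, LinearMap.id_apply] at h2
    show cutLin F hkq (eQ (V'.mkQ v)) = y
    rw [hv, LinearEquiv.apply_symm_apply, h2]
  obtain ⟨σ, hσ⟩ := π.exists_rightInverse_of_surjective hπ
  have hπTφ : (π ∘ₗ T) ∘ₗ φ = 0 := by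
    apply LinearMap.ext
    intro y
    have hmem : T (φ y) ∈ V' := Submodule.mem_map_of_mem (eW.symm y).2
    show cutLin F hkq (eQ (V'.mkQ (T (φ y)))) = 0
    rw [Submodule.mkQ_apply, (Submodule.Quotient.mk_eq_zero V').2 hmem, map_zero, map_zero]
  refine ⟨LinearMap.toMatrix' π, LinearMap.toMatrix' φ, LinearMap.toMatrix' σ, LinearMap.toMatrix' ψ,
    ?_, ?_, ?_⟩
  · rw [← LinearMap.toMatrix'_comp, hσ, LinearMap.toMatrix'_id]
  · rw [← LinearMap.toMatrix'_comp, hψ, LinearMap.toMatrix'_id]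
  · rw [show A = LinearMap.toMatrix' T from (LinearMap.toMatrix'_toLin' A).symm,
      ← LinearMap.toMatrix'_comp, ← LinearMap.toMatrix'_comp, hπTφ, map_zero]

end Existence

section Blocks

variable {R : Type*} [CommRing R] {κ ρ : Type*} [Fintype κ] [Fintype ρ] [DecidableEq κ] [DecidableEq ρ]

/-- `g(X, 1, 0) · diag(1, s) · g(0, 1, Z) = g(X, s, Z)` (Bruhat-type factorisation of a block point). -/
theorem blockPt_mul_diag_mul_blockPt (X : Matrix ρ κ R) (s : Matrix ρ ρ R) (Z : Matrix κ ρ R) :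
    blockPt X 1 0 * Matrix.fromBlocks 1 0 0 s * blockPt 0 1 Z = blockPt X s Z := by
  simp [blockPt, Matrix.fromBlocks_multiply]

end Blocks

section Unipotents

variable {p : ℕ} {k r m : ℕ}

/-- `e(diag(1, D))` satisfies the CORNER support predicate (`t - 1` lives in rows `≥ k`, columns `≥ k`)
whenever `e` sends `inr` into `{k, …, m-1}`. -/
theorem corner_of_val_eq (e : Fin k ⊕ Fin r ≃ Fin m) (he₁ : ∀ i : Fin r, k ≤ (e (Sum.inr i)).val)
    (D : Matrix (Fin r) (Fin r) (ZMod p)) {t : GLm p m}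
    (ht : (t : Mat p m) = Matrix.reindex e e (Matrix.fromBlocks 1 0 0 D)) :
    ∀ i j : Fin m, ((t : Mat p m) - 1) i j ≠ 0 → k ≤ i.val ∧ k ≤ j.val := by
  intro i j hij
  obtain ⟨i', rfl⟩ := e.surjective i
  obtain ⟨j', rfl⟩ := e.surjective j
  rw [ht, reindex_sub_one_apply] at hij
  rcases i' with i' | i' <;> rcases j' with j' | j'
  · simp [Matrix.one_apply] at hij
  · simp at hij
  · simp at hij
  · exact ⟨he₁ i', he₁ j'⟩

variable [Fact p.Prime]

/-- `rank (D - 1) ≤ rank (e(diag(1, D)) - 1)` (`D - 1` is a submatrix of `t - 1`). -/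
theorem rank_sub_one_le (e : Fin k ⊕ Fin r ≃ Fin m) (D : Matrix (Fin r) (Fin r) (ZMod p)) {t : GLm p m}
    (ht : (t : Mat p m) = Matrix.reindex e e (Matrix.fromBlocks 1 0 0 D)) :
    (D - 1).rank ≤ ((t : Mat p m) - 1).rank := by
  have hsub : D - 1 = ((t : Mat p m) - 1).submatrix (fun i => e (Sum.inr i)) (fun j => e (Sum.inr j)) := by
    ext i j
    rw [Matrix.submatrix_apply, ht, reindex_sub_one_apply]
    simp [Matrix.one_apply]
  rw [hsub]
  exact Matrix.rank_submatrix_le _ _ _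

/-- **Levi collision at level `k`, given a collision pair.**  If `U⁻ ≤ H₁`, `U⁺ ≤ H₃`, the triple passes
the level-`k` identity test, some product `abg` has transported block form `g(X₀, D, Z₀)` with `D ≠ 1`, and
`γ (D - 1) β = 0` for a right-invertible `γ` and a left-invertible `β`, contradiction: all `g(X, D, Z)` and
`g(X, 1, Z)` lie in `H₁H₂H₃` (the proof of `LevelKCornerSlice.false_of_idTest_of_schur_ne_one` verbatim). -/
theorem false_of_idTest_of_pair (e : Fin k ⊕ Fin r ≃ Fin m)
    (he₀ : ∀ j : Fin k, (e (Sum.inl j)).val < k) (he₁ : ∀ i : Fin r, k ≤ (e (Sum.inr i)).val)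
    {H₁ H₂ H₃ : Subgroup (GLm p m)}
    (hU : ∀ u : GLm p m, (∀ i j : Fin m, ((u : Mat p m) - 1) i j ≠ 0 → k ≤ i.val ∧ j.val < k) → u ∈ H₁)
    (hV : ∀ v : GLm p m, (∀ i j : Fin m, ((v : Mat p m) - 1) i j ≠ 0 → i.val < k ∧ k ≤ j.val) → v ∈ H₃)
    (c : Mat p m → ℂ) (hc : ∀ M, k < M.rank → c M = 0)
    (h1 : (∑ M : Mat p m, c M * ZMod.stdAddChar (Matrix.trace (M * ((1 : GLm p m) : Mat p m)))) = 1)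
    (h0 : ∀ a ∈ H₁, ∀ b ∈ H₂, ∀ g ∈ H₃, a * b * g ≠ 1 →
      (∑ M : Mat p m, c M * ZMod.stdAddChar (Matrix.trace (M * ((a * b * g : GLm p m) : Mat p m)))) = 0)
    {a b g : GLm p m} (ha : a ∈ H₁) (hb : b ∈ H₂) (hg : g ∈ H₃)
    (X₀ : Matrix (Fin r) (Fin k) (ZMod p)) (D : Matrix (Fin r) (Fin r) (ZMod p))
    (Z₀ : Matrix (Fin k) (Fin r) (ZMod p))
    (hx : ((a * b * g : GLm p m) : Mat p m) = Matrix.reindex e e (blockPt X₀ D Z₀)) (hD : D ≠ 1)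
    (γ : Matrix (Fin k) (Fin r) (ZMod p)) (β : Matrix (Fin r) (Fin k) (ZMod p))
    (γ' : Matrix (Fin r) (Fin k) (ZMod p)) (β' : Matrix (Fin k) (Fin r) (ZMod p))
    (hγ : γ * γ' = 1) (hβ : β' * β = 1) (hcol : γ * (D - 1) * β = 0) : False := by
  have hdet : ∀ (X : Matrix (Fin r) (Fin k) (ZMod p)) (Z : Matrix (Fin k) (Fin r) (ZMod p)),
      (blockPt X (1 : Matrix (Fin r) (Fin r) (ZMod p)) Z).det ≠ 0 := fun X Z => by
    rw [det_blockPt, Matrix.det_one]; exact one_ne_zero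
  -- the transported product set `H₁H₂H₃`
  let S : Set (Matrix (Fin k ⊕ Fin r) (Fin k ⊕ Fin r) (ZMod p)) :=
    {s | ∃ a ∈ H₁, ∃ b ∈ H₂, ∃ g ∈ H₃, Matrix.reindex e e s = ((a * b * g : GLm p m) : Mat p m)}
  have hSt : ∀ (X : Matrix (Fin r) (Fin k) (ZMod p)) (Z : Matrix (Fin k) (Fin r) (ZMod p)),
      blockPt X D Z ∈ S := by
    intro X Z
    obtain ⟨u, hu⟩ := exists_gl_val_eq e _ (hdet (X - X₀) 0)
    obtain ⟨v, hv⟩ := exists_gl_val_eq e _ (hdet 0 (Z - Z₀))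
    refine ⟨u * a, H₁.mul_mem (hU u (lower_of_val_eq e he₀ he₁ _ hu)) ha, b, hb, g * v,
      H₃.mul_mem hg (hV v (upper_of_val_eq e he₀ he₁ _ hv)), ?_⟩
    have hassoc : u * a * b * (g * v) = u * (a * b * g) * v := by simp only [mul_assoc]
    rw [hassoc, Units.val_mul, Units.val_mul, hu, hx, hv, reindex_mul_reindex, reindex_mul_reindex,
      blockPt_one_zero_mul, sub_add_cancel, blockPt_mul_zero_one, add_sub_cancel]
  have hS1 : ∀ (X : Matrix (Fin r) (Fin k) (ZMod p)) (Z : Matrix (Fin k) (Fin r) (ZMod p)),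
      blockPt X 1 Z ∈ S := by
    intro X Z
    obtain ⟨u, hu⟩ := exists_gl_val_eq e _ (hdet X 0)
    obtain ⟨v, hv⟩ := exists_gl_val_eq e _ (hdet 0 Z)
    refine ⟨u, hU u (lower_of_val_eq e he₀ he₁ _ hu), 1, H₂.one_mem, v,
      hV v (upper_of_val_eq e he₀ he₁ _ hv), ?_⟩
    rw [mul_one, Units.val_mul, hu, hv, reindex_mul_reindex, blockPt_one_zero_mul, add_zero]
  -- the transported coefficient table
  let c' : Matrix (Fin k ⊕ Fin r) (Fin k ⊕ Fin r) (ZMod p) → ℂ := fun M' => c (Matrix.reindex e e M')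
  have hc' : ∀ M', Fintype.card (Fin k) < M'.rank → c' M' = 0 := by
    intro M' hM'
    apply hc
    rw [Matrix.rank_reindex]
    simpa using hM'
  have h1' : (∑ M' : Matrix (Fin k ⊕ Fin r) (Fin k ⊕ Fin r) (ZMod p),
      c' M' * ZMod.stdAddChar (Matrix.trace (M' * 1))) = 1 := by
    have := LevelOneCornerSlice.fourier_reindex e c 1
    rw [Matrix.reindex_apply, Matrix.submatrix_one_equiv] at this
    rw [← this]
    rwa [Units.val_one] at h1
  have h0' : ∀ s ∈ S, s ≠ 1 → (∑ M' : Matrix (Fin k ⊕ Fin r) (Fin k ⊕ Fin r) (ZMod p),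
      c' M' * ZMod.stdAddChar (Matrix.trace (M' * s))) = 0 := by
    rintro s ⟨a', ha', b', hb', g', hg', hs⟩ hs1
    have hne : a' * b' * g' ≠ 1 := by
      intro h
      apply hs1
      rw [h, Units.val_one] at hs
      have : s = (Matrix.reindex e e).symm 1 := by rw [← hs]; simp
      rw [this, Matrix.reindex_symm, Matrix.reindex_apply, Matrix.submatrix_one_equiv]
    have h := h0 a' ha' b' hb' g' hg' hne
    rw [← hs, LevelOneCornerSlice.fourier_reindex] at h
    exact h
  exact no_idTest_of_leviCollision γ β γ' β' hγ hβ D hD hcol S hSt hS1 c' hc' h1' h0'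

/-- **The partial corner slice of a level-`k` sandwich, `2k ≤ m`** (named-hypothesis form of
`stub_levelKPartialCornerSlice`): a corner-`1` product `abg` factors as `u · t · v`, `u ∈ U⁻`, `v ∈ U⁺`,
`t = e(diag(1, D))` corner-shaped, with `t = 1` or `2(m - 2k) < rank (t - 1)`. -/
theorem partialCornerSlice (hkm : 2 * k ≤ m) {H₁ H₂ H₃ : Subgroup (GLm p m)}
    (hU : ∀ u : GLm p m, (∀ i j : Fin m, ((u : Mat p m) - 1) i j ≠ 0 → k ≤ i.val ∧ j.val < k) → u ∈ H₁)
    (hV : ∀ v : GLm p m, (∀ i j : Fin m, ((v : Mat p m) - 1) i j ≠ 0 → i.val < k ∧ k ≤ j.val) → v ∈ H₃)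
    (hid : ∃ c : Mat p m → ℂ, (∀ M, k < M.rank → c M = 0) ∧
      (∑ M : Mat p m, c M * ZMod.stdAddChar (Matrix.trace (M * ((1 : GLm p m) : Mat p m)))) = 1 ∧
      ∀ a ∈ H₁, ∀ b ∈ H₂, ∀ g ∈ H₃, a * b * g ≠ 1 →
        (∑ M : Mat p m, c M * ZMod.stdAddChar (Matrix.trace (M * ((a * b * g : GLm p m) : Mat p m)))) = 0)
    {a b g : GLm p m} (ha : a ∈ H₁) (hb : b ∈ H₂) (hg : g ∈ H₃)
    (hcorner : ∀ i j : Fin m, i.val < k → j.val < k → (((a * b * g : GLm p m) : Mat p m) - 1) i j = 0) :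
    ∃ u t v : GLm p m,
      (∀ i j : Fin m, ((u : Mat p m) - 1) i j ≠ 0 → k ≤ i.val ∧ j.val < k) ∧
      (∀ i j : Fin m, ((t : Mat p m) - 1) i j ≠ 0 → k ≤ i.val ∧ k ≤ j.val) ∧
      (∀ i j : Fin m, ((v : Mat p m) - 1) i j ≠ 0 → i.val < k ∧ k ≤ j.val) ∧
      a * b * g = u * t * v ∧ (t = 1 ∨ 2 * (m - 2 * k) < ((t : Mat p m) - 1).rank) := by
  obtain ⟨c, hc, h1, h0⟩ := hid
  -- coordinates `Fin k ⊕ Fin (m - k) ≃ Fin m`, `inl j ↦ j`, `inr i ↦ k + i`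
  have hkm' : k + (m - k) = m := by omega
  set e : Fin k ⊕ Fin (m - k) ≃ Fin m := finSumFinEquiv.trans (finCongr hkm') with he
  have he₀ : ∀ j : Fin k, (e (Sum.inl j)).val < k := fun j => by simp [he]
  have he₁ : ∀ i : Fin (m - k), k ≤ (e (Sum.inr i)).val := fun i => by simp [he]
  -- block form of `x = abg`: corner block `1`, hence `x = e(g(c, D, r))` with the Schur complement `D`
  set x' : Matrix (Fin k ⊕ Fin (m - k)) (Fin k ⊕ Fin (m - k)) (ZMod p) :=
    (Matrix.reindex e e).symm ((a * b * g : GLm p m) : Mat p m) with hx'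
  have hx : ((a * b * g : GLm p m) : Mat p m) = Matrix.reindex e e x' :=
    ((Matrix.reindex e e).apply_symm_apply _).symm
  have h11 : x'.toBlocks₁₁ = 1 := by
    ext i j
    have h := hcorner (e (Sum.inl i)) (e (Sum.inl j)) (he₀ i) (he₀ j)
    rw [hx, reindex_sub_one_apply, Matrix.sub_apply, sub_eq_zero] at h
    rw [Matrix.toBlocks₁₁, Matrix.of_apply, h]
    simp [Matrix.one_apply]
  have hxb := eq_blockPt_of_toBlocks₁₁ x' h11
  rw [hxb] at hx
  set D : Matrix (Fin (m - k)) (Fin (m - k)) (ZMod p) := x'.toBlocks₂₂ - x'.toBlocks₂₁ * x'.toBlocks₁₂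
    with hD
  -- `det D = det x ≠ 0`
  have hdetD : D.det ≠ 0 := by
    have h := (Matrix.GeneralLinearGroup.det (a * b * g)).ne_zero
    rw [Matrix.GeneralLinearGroup.val_det_apply, hx, Matrix.det_reindex_self, det_blockPt] at h
    exact h
  -- the three factors
  obtain ⟨u, hu⟩ := exists_gl_val_eq e (blockPt x'.toBlocks₂₁ 1 (0 : Matrix (Fin k) (Fin (m - k)) (ZMod p)))
    (by rw [det_blockPt, Matrix.det_one]; exact one_ne_zero)
  obtain ⟨v, hv⟩ := exists_gl_val_eq e (blockPt (0 : Matrix (Fin (m - k)) (Fin k) (ZMod p)) 1 x'.toBlocks₁₂)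
    (by rw [det_blockPt, Matrix.det_one]; exact one_ne_zero)
  obtain ⟨t, ht⟩ := exists_gl_val_eq e (Matrix.fromBlocks 1 0 0 D)
    (by rw [Matrix.det_fromBlocks_zero₁₂, Matrix.det_one, one_mul]; exact hdetD)
  refine ⟨u, t, v, lower_of_val_eq e he₀ he₁ _ hu, corner_of_val_eq e he₁ D ht,
    upper_of_val_eq e he₀ he₁ _ hv, ?_, ?_⟩
  · apply Units.ext
    rw [hx, Units.val_mul, Units.val_mul, hu, ht, hv, reindex_mul_reindex, reindex_mul_reindex,
      blockPt_mul_diag_mul_blockPt]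
  · by_cases hD1 : D = 1
    · left
      apply Units.ext
      rw [ht, hD1, Matrix.fromBlocks_one, Units.val_one, Matrix.reindex_apply, Matrix.submatrix_one_equiv]
    · right
      by_contra hlt
      have hle : (D - 1).rank ≤ 2 * (m - k - k) := by
        have := rank_sub_one_le e D ht
        omega
      obtain ⟨γ, β, γ', β', hγ, hβ, hcol⟩ :=
        exists_leviCollision_pair_of_rank_le (F := ZMod p) (by omega : k ≤ m - k) (D - 1) hle
      exact false_of_idTest_of_pair e he₀ he₁ hU hV c hc h1 h0 ha hb hg _ D _ hx hD1 γ β γ' β' hγ hβ hcol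

end Unipotents

end LevelKPartialCornerSlice

/-- **Stub `stub_levelKPartialCornerSlice` (line `ghost-calculus-chebotarev`).**  For a level-`k` sandwich
`U⁻ ≤ H₁`, `U⁺ ≤ H₃` in `GL_m(𝔽_p)` (`1 ≤ k`, `2k ≤ m`) passing the level-`k` identity test, every product
`abg` (`a ∈ H₁`, `b ∈ H₂`, `g ∈ H₃`) whose top-left `k × k` block is the identity factors as `u t v` with
`u ∈ U⁻`, `v ∈ U⁺`, `t` corner-shaped, and either `t = 1` or `2(m - 2k) < rank (t - 1)`. -/
theorem stub_levelKPartialCornerSlice :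
    ∀ (p : ℕ) [Fact p.Prime] (m k : ℕ), 1 ≤ k → 2 * k ≤ m →
      ∀ (H₁ H₂ H₃ : Subgroup (Matrix.GeneralLinearGroup (Fin m) (ZMod p))),
      (∀ u : Matrix.GeneralLinearGroup (Fin m) (ZMod p),
        (∀ i j : Fin m, ((u : Matrix (Fin m) (Fin m) (ZMod p)) - 1) i j ≠ 0 → k ≤ i.val ∧ j.val < k) →
          u ∈ H₁) →
      (∀ v : Matrix.GeneralLinearGroup (Fin m) (ZMod p),
        (∀ i j : Fin m, ((v : Matrix (Fin m) (Fin m) (ZMod p)) - 1) i j ≠ 0 → i.val < k ∧ k ≤ j.val) →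
          v ∈ H₃) →
      (∃ c : Matrix (Fin m) (Fin m) (ZMod p) → ℂ, (∀ M, k < M.rank → c M = 0) ∧
        (∑ M : Matrix (Fin m) (Fin m) (ZMod p), c M * ZMod.stdAddChar (Matrix.trace
          (M * ((1 : Matrix.GeneralLinearGroup (Fin m) (ZMod p)) : Matrix (Fin m) (Fin m) (ZMod p))))) = 1 ∧
        ∀ a ∈ H₁, ∀ b ∈ H₂, ∀ g ∈ H₃, a * b * g ≠ 1 →
          (∑ M : Matrix (Fin m) (Fin m) (ZMod p), c M * ZMod.stdAddChar (Matrix.trace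
            (M * ((a * b * g : Matrix.GeneralLinearGroup (Fin m) (ZMod p)) :
              Matrix (Fin m) (Fin m) (ZMod p))))) = 0) →
      ∀ a ∈ H₁, ∀ b ∈ H₂, ∀ g ∈ H₃,
        (∀ i j : Fin m, i.val < k → j.val < k →
          (((a * b * g : Matrix.GeneralLinearGroup (Fin m) (ZMod p)) : Matrix (Fin m) (Fin m) (ZMod p)) - 1)
            i j = 0) →
        ∃ u t v : Matrix.GeneralLinearGroup (Fin m) (ZMod p),
          (∀ i j : Fin m, ((u : Matrix (Fin m) (Fin m) (ZMod p)) - 1) i j ≠ 0 → k ≤ i.val ∧ j.val < k) ∧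
          (∀ i j : Fin m, ((t : Matrix (Fin m) (Fin m) (ZMod p)) - 1) i j ≠ 0 → k ≤ i.val ∧ k ≤ j.val) ∧
          (∀ i j : Fin m, ((v : Matrix (Fin m) (Fin m) (ZMod p)) - 1) i j ≠ 0 → i.val < k ∧ k ≤ j.val) ∧
          a * b * g = u * t * v ∧
          (t = 1 ∨ 2 * (m - 2 * k) < ((t : Matrix (Fin m) (Fin m) (ZMod p)) - 1).rank) :=
  fun _ _ _ _ _ hkm _ _ _ hU hV hid _ ha _ hb _ hg hcorner =>
    LevelKPartialCornerSlice.partialCornerSlice hkm hU hV hid ha hb hg hcorner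

end Summit.MatrixMultiplication.MatrixMultiplication.Theorems.SubgroupIdentityDesigns.Negative

end
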